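import Summits.Ventures.PercRepro.RankLevelSetLevelSixArithD

/-!
# PercRepro — THE LEVEL-`6` ARITHMETIC AT CORANKS `7 … 50`, PART E (night-1, gen 4)

`proofs/NIGHT-1-C025-induction.md` §15.9. The recipe of `RankLevelSetLevelFourArith` / `RankLevelSetLevelFiveArith` at
level `6` with the flat bound `f(6) ≤ 43` (`σ(d) = Σ_{j ≤ d−7} C(36, j)`): the polynomial inequalities

  (P_d)  `8·(C(n, 6) + σ(d)·(C(d+2, 3)·C(n, 4) + C(d+3, 4)·C(n, 3) + C(d+4, 5)·C(n, 2) + C(d+5, 6)·n + C(d+6, 7)))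
          ≤ 7·2^{d−6}·C(p+6, 6)`,   `n = p + d`,

for every `p ≥ 124425` — with `p = 124425 + t` the difference has non-negative coefficients
(`mining/night-1/g4/coeffs6.py`; least thresholds `thresholds6.py`, the maximum `124425` at `d = 21`). Part A: `d = 7 … 17` (+ the
helper `choose_six_mul`); Part B: `d = 18 … 28`; Part C: `d = 29 … 39`; Part D: `d = 40 … 50`; Part E: the tail
`16·Σ_{j ≤ 50} C(n, j) ≤ 2^n` for `n ≥ 118` and `level_six_poly`.
Axioms: standard.
-/

namespace PercRepro


/-- **The binomial tail**: `16·Σ_{j ≤ 50} C(n, j) ≤ 2^n` for every `n ≥ 118`. -/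
theorem sixteen_mul_sum_choose_le_fifty (n : ℕ) (hn : 118 ≤ n) :
    16 * ∑ j ∈ Finset.range 51, n.choose j ≤ 2 ^ n := by
  induction n, hn using Nat.le_induction with
  | base =>
    simp only [Finset.sum_range_succ]
    norm_num [Nat.choose]
  | succ n hn ih =>
    have h : ∑ j ∈ Finset.range 51, (n + 1).choose j ≤ 2 * ∑ j ∈ Finset.range 51, n.choose j :=
      sum_choose_succ_le_two_mul n 50
    rw [pow_succ]
    omega

/-- **`(P_d)` at level `6`, every corank `7 ≤ d ≤ 50`, every `p ≥ 124425`.** -/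
theorem level_six_poly (d : ℕ) (hd7 : 7 ≤ d) (hd50 : d ≤ 50) (p : ℕ) (hp : 124425 ≤ p) :
    8 * ((p + d).choose 6 + (∑ j ∈ Finset.range (d - 7 + 1), Nat.choose 36 j) *
      ((d + 2).choose 3 * (p + d).choose 4 + (d + 3).choose 4 * (p + d).choose 3 +
        (d + 4).choose 5 * (p + d).choose 2 + (d + 5).choose 6 * (p + d) + (d + 6).choose 7)) ≤
      7 * 2 ^ (d - 6) * (p + 6).choose 6 := by
  interval_cases d
  · exact level_six_poly_7 p hp
  · exact level_six_poly_8 p hp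
  · exact level_six_poly_9 p hp
  · exact level_six_poly_10 p hp
  · exact level_six_poly_11 p hp
  · exact level_six_poly_12 p hp
  · exact level_six_poly_13 p hp
  · exact level_six_poly_14 p hp
  · exact level_six_poly_15 p hp
  · exact level_six_poly_16 p hp
  · exact level_six_poly_17 p hp
  · exact level_six_poly_18 p hp
  · exact level_six_poly_19 p hp
  · exact level_six_poly_20 p hp
  · exact level_six_poly_21 p hp
  · exact level_six_poly_22 p hp
  · exact level_six_poly_23 p hp
  · exact level_six_poly_24 p hp
  · exact level_six_poly_25 p hp
  · exact level_six_poly_26 p hp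
  · exact level_six_poly_27 p hp
  · exact level_six_poly_28 p hp
  · exact level_six_poly_29 p hp
  · exact level_six_poly_30 p hp
  · exact level_six_poly_31 p hp
  · exact level_six_poly_32 p hp
  · exact level_six_poly_33 p hp
  · exact level_six_poly_34 p hp
  · exact level_six_poly_35 p hp
  · exact level_six_poly_36 p hp
  · exact level_six_poly_37 p hp
  · exact level_six_poly_38 p hp
  · exact level_six_poly_39 p hp
  · exact level_six_poly_40 p hp
  · exact level_six_poly_41 p hp
  · exact level_six_poly_42 p hp
  · exact level_six_poly_43 p hp
  · exact level_six_poly_44 p hp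
  · exact level_six_poly_45 p hp
  · exact level_six_poly_46 p hp
  · exact level_six_poly_47 p hp
  · exact level_six_poly_48 p hp
  · exact level_six_poly_49 p hp
  · exact level_six_poly_50 p hp

end PercRepro
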